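import Summits.PneNP.PneNP.Theorems.ConvexRankGatesConvexGateBlindExactLiftingTriangleIsolation

/-!
# Triangle instance — line isolation with closeness on NONDEGENERATE rows only, file 1: identity and bounds

Support file for crux `ConvexGateBlind` (stmt-PneNP-10680), open stub `stub_exactLifting`; prover seat 0, session 35,
memo ANALYSIS14 §3. THEOREM B (`TriLine.isolation`, session 22) assumed the rows `η`-close to the line pattern on ALL
rows; but its certificate never looks at DEGENERATE rows (a block monochromatic): the cube weights `wt x ·` vanish
identically there and the good-row masses carry the factor `mu x = 0`. This is exactly what the corrected bridge
(`…TriangleJumpGen`) needs, because on degenerate rows the line representation is not unique (`…TriangleJumpVacuous`) and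
no closeness can be expected there. This file and `…IsolationNDOffLine`, `…IsolationND` re-run the chain
`…IsolationIdentity` ⟵ `…IsolationOffLine` ⟵ `…Isolation` for the weaker structure `IsLineFactND` (closeness required only
where `mu x ≠ 0`); the proofs are those of session 22 verbatim except at the two places where closeness was used on all
rows (`C_le`: degenerate rows contribute `0` to `C`; `sum_rest_le`: the per-row bound is only needed with weight `mu x`).
All `h`-free ingredients (kernel, block sums, constants) are imported, not copied.
-/

set_option linter.dupNamespace false -- `Summit.PneNP.PneNP.…`: summit = sub-problem (D-0017)

namespace Summit.PneNP.PneNP.Theorems.XorDoor.TriLine.ND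

open Finset

noncomputable section

variable {t : ℕ}

/-- A LINE-LABELLED FACTORISATION of `M_t − εJ` with normalised columns and rows `η`-close to the line pattern ON THE
NONDEGENERATE ROWS (`mu x ≠ 0`, i.e. every block two-coloured); nothing is asked of the usage on degenerate rows. -/
structure IsLineFactND (t : ℕ) (ε η : ℝ) (u : Line t → Col t → ℝ) (v : Line t → Tri t → ℝ) : Prop where
  u_nonneg : ∀ L x, 0 ≤ u L x
  v_nonneg : ∀ L w, 0 ≤ v L w
  fact : ∀ x w, ∑ L, u L x * v L w = (monoCount x w : ℝ) - ε
  norm : ∀ L, ∑ w, lind L w * v L w = t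
  eta_nonneg : 0 ≤ η
  close : ∀ L x, mu x ≠ 0 → |u L x - mInd x L| ≤ η

/-- the original structure (closeness on all rows) is a special case -/
lemma of_isLineFact {ε η : ℝ} {u : Line t → Col t → ℝ} {v : Line t → Tri t → ℝ} (h : IsLineFact t ε η u v) :
    IsLineFactND t ε η u v :=
  ⟨h.u_nonneg, h.v_nonneg, h.fact, h.norm, h.eta_nonneg, fun L x _ => h.close L x⟩

variable {ε η : ℝ} {u : Line t → Col t → ℝ} {v : Line t → Tri t → ℝ}

/-- the cube weights vanish on degenerate rows -/
lemma nw_eq_zero_of_mu {x : Col t} (hx : mu x = 0) (w : Tri t) : nw x w = 0 := by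
  have hcp : ∀ (y : Fin t → Bool) (v₀ : Fin t), cp y = 0 → dc y v₀ = 0 := by
    intro y v₀ hy
    have := sum_dc y
    rw [hy, mul_zero] at this
    exact Finset.sum_eq_zero_iff.1 this v₀ (mem_univ _)
  unfold mu at hx
  unfold nw
  rcases mul_eq_zero.1 hx with h12 | h3
  · rcases mul_eq_zero.1 h12 with h1 | h2
    · rw [hcp x.1 w.1 (by exact_mod_cast h1)]; simp
    · rw [hcp x.2.1 w.2.1 (by exact_mod_cast h2)]; simp
  · rw [hcp x.2.2 w.2.2 (by exact_mod_cast h3)]; simp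

/-- `|E_L(x)| · nw x w ≤ η · nw x w` on every row: closeness where `mu x ≠ 0`, vanishing weights elsewhere -/
lemma abs_Efn_mul_nw_le (h : IsLineFactND t ε η u v) (L : Line t) (x : Col t) (w : Tri t) :
    |Efn u L x| * nw x w ≤ η * nw x w := by
  by_cases hx : mu x = 0
  · rw [nw_eq_zero_of_mu hx]; simp
  · exact mul_le_mul_of_nonneg_right (h.close L x hx) (nw_nonneg x w)

/-- `E ≥ 0` on bichromatic lines (there the pattern is `0` and `u ≥ 0`) -/
lemma Efn_nonneg_of_not_lmono (h : IsLineFactND t ε η u v) {L : Line t} {x : Col t} (hm : ¬ lmono x L) :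
    0 ≤ Efn u L x := by
  unfold Efn mInd; rw [if_neg hm, sub_zero]; exact h.u_nonneg L x

/-- `Δ ≥ 0` off the line (there `1_L = 0` and `v ≥ 0`) -/
lemma Dfn_nonneg_of_not_lmem (h : IsLineFactND t ε η u v) {L : Line t} {w : Tri t} (hm : ¬ lmem L w) :
    0 ≤ Dfn v L w := by
  unfold Dfn; rw [lind_of_not_lmem hm, sub_zero]; exact h.v_nonneg L w

/-- `|Δ| = (1 − 1_L) Δ + 1_L |Δ|` (off the line `Δ ≥ 0`) -/
lemma abs_Dfn_eq (h : IsLineFactND t ε η u v) (L : Line t) (w : Tri t) :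
    |Dfn v L w| = (1 - lind L w) * Dfn v L w + lind L w * |Dfn v L w| := by
  by_cases hm : lmem L w
  · rw [lind_of_lmem hm]; ring
  · rw [lind_of_not_lmem hm, abs_of_nonneg (Dfn_nonneg_of_not_lmem h hm)]; ring

/-- the on-line part of `Δ_L` has mean zero -/
lemma sum_lind_mul_Dfn (h : IsLineFactND t ε η u v) (L : Line t) : ∑ w, lind L w * Dfn v L w = 0 := by
  have h1 : ∀ w, lind L w * Dfn v L w = lind L w * v L w - lind L w := by
    intro w; unfold Dfn lind; split_ifs <;> ring
  simp only [h1, sum_sub_distrib, h.norm L, sum_lind L, sub_self]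

/-- **(★)** the factorisation expanded around the line pattern -/
lemma star (h : IsLineFactND t ε η u v) (x : Col t) (w : Tri t) :
    ∑ L, mInd x L * Dfn v L w + ∑ L, Efn u L x * lind L w + ∑ L, Efn u L x * Dfn v L w = -ε := by
  have hf := h.fact x w
  have h1 : ∑ L, u L x * v L w = ∑ L, (mInd x L + Efn u L x) * (lind L w + Dfn v L w) := by
    refine sum_congr rfl fun L _ => ?_; unfold Efn Dfn; ring
  have h2 : ∑ L : Line t, mInd x L * lind L w = (monoCount x w : ℝ) := by
    rw [monoCount_eq_sum_lines]
    refine sum_congr rfl fun L _ => ?_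
    unfold mInd lind
    by_cases hm : lmono x L <;> by_cases hl : lmem L w <;> simp [hm, hl]
  have h3 : ∑ L, (mInd x L + Efn u L x) * (lind L w + Dfn v L w) = ∑ L : Line t, mInd x L * lind L w
      + (∑ L, mInd x L * Dfn v L w + ∑ L, Efn u L x * lind L w + ∑ L, Efn u L x * Dfn v L w) := by
    simp only [← sum_add_distrib]; refine sum_congr rfl fun L _ => ?_; ring
  linarith [h1, h2, h3, hf]

/-- **The averaged identity** `A + B + C = −4ε M`. -/
theorem identity (h : IsLineFactND t ε η u v) : Aq v + Bq u + Cq u v = -4 * ε * Mq t := by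
  -- multiply (★)(x,w) by `wt x w`, sum over `w` and then over `x`
  have hx : ∀ x : Col t, ∑ w, wt x w * (∑ L, mInd x L * Dfn v L w) + ∑ L, Efn u L x * ∑ w, wt x w * lind L w
      + ∑ L, Efn u L x * ∑ w, wt x w * Dfn v L w = -4 * ε * mu x := by
    intro x
    have h2 : ∀ f : Line t → Tri t → ℝ, ∑ w, wt x w * ∑ L, Efn u L x * f L w
        = ∑ L, Efn u L x * ∑ w, wt x w * f L w := by
      intro f
      simp only [mul_sum]
      rw [sum_comm]
      refine sum_congr rfl fun L _ => sum_congr rfl fun w _ => ?_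
      ring
    rw [← h2, ← h2, ← sum_add_distrib, ← sum_add_distrib]
    calc ∑ w, (wt x w * (∑ L, mInd x L * Dfn v L w) + wt x w * ∑ L, Efn u L x * lind L w
          + wt x w * ∑ L, Efn u L x * Dfn v L w)
        = ∑ w, wt x w * (∑ L, mInd x L * Dfn v L w + ∑ L, Efn u L x * lind L w
            + ∑ L, Efn u L x * Dfn v L w) := by
          refine sum_congr rfl fun w _ => ?_; ring
      _ = ∑ w, wt x w * (-ε) := sum_congr rfl fun w _ => by rw [star h x w]
      _ = -4 * ε * mu x := by rw [← sum_mul, sum_wt]; ring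
  have hA : Aq v = ∑ x : Col t, ∑ w, wt x w * ∑ L, mInd x L * Dfn v L w := by
    unfold Aq
    simp only [ker_eq_sum_mInd, sum_mul, mul_sum]
    calc ∑ L : Line t, ∑ w : Tri t, ∑ x : Col t, mInd x L * wt x w * Dfn v L w
        = ∑ L : Line t, ∑ x : Col t, ∑ w : Tri t, mInd x L * wt x w * Dfn v L w :=
          sum_congr rfl fun L _ => sum_comm
      _ = ∑ x : Col t, ∑ L : Line t, ∑ w : Tri t, mInd x L * wt x w * Dfn v L w := sum_comm
      _ = ∑ x : Col t, ∑ w : Tri t, ∑ L : Line t, wt x w * (mInd x L * Dfn v L w) := by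
          refine sum_congr rfl fun x _ => ?_
          rw [sum_comm]
          refine sum_congr rfl fun w _ => sum_congr rfl fun L _ => ?_
          ring
  rw [hA, Bq, Cq, Mq, ← sum_add_distrib, ← sum_add_distrib, mul_sum]
  exact sum_congr rfl fun x _ => hx x

/-- `S_off ≥ 0` -/
lemma Soff_nonneg (h : IsLineFactND t ε η u v) : 0 ≤ Soff v := by
  unfold Soff
  refine sum_nonneg fun L _ => sum_nonneg fun w _ => ?_
  by_cases hm : lmem L w
  · rw [lind_of_lmem hm]; simp
  · rw [lind_of_not_lmem hm]; simpa using Dfn_nonneg_of_not_lmem h hm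

/-- `B̃ ≥ 0` -/
lemma Bt_nonneg (h : IsLineFactND t ε η u v) : 0 ≤ Bt u := by
  unfold Bt
  refine sum_nonneg fun x _ => sum_nonneg fun L _ => ?_
  split_ifs with hm
  · exact le_rfl
  · exact mul_nonneg (Efn_nonneg_of_not_lmono h hm) (mu_nonneg x)

/-- **Bound on `A`**: the kernel is `0` on the line and `≥ Kmin/128` off it, where `Δ ≥ 0`. -/
theorem A_ge (h : IsLineFactND t ε η u v) : Kmin t * Soff v ≤ 128 * Aq v := by
  unfold Soff Aq
  rw [mul_sum, mul_sum]
  refine sum_le_sum fun L _ => ?_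
  rw [mul_sum, mul_sum]
  refine sum_le_sum fun w _ => ?_
  by_cases hm : lmem L w
  · rw [lind_of_lmem hm, ker_eq_zero_of_lmem hm]; simp
  · rw [lind_of_not_lmem hm]
    have hk := ker_ge_of_not_lmem hm
    have hD := Dfn_nonneg_of_not_lmem h hm
    calc Kmin t * ((1 - 0) * Dfn v L w) = Kmin t * Dfn v L w := by ring
      _ ≤ (128 * ker L w) * Dfn v L w := mul_le_mul_of_nonneg_right hk hD
      _ = 128 * (ker L w * Dfn v L w) := by ring

/-- **Bounds on `B`**: `0 ≤ B` and `2 B̃ ≤ t² B`. -/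
theorem B_ge (h : IsLineFactND t ε η u v) : 0 ≤ Bq u ∧ 2 * Bt u ≤ (t : ℝ) ^ 2 * Bq u := by
  have key : ∀ x L, 0 ≤ Efn u L x * ∑ w : Tri t, wt x w * lind L w ∧
      2 * (if lmono x L then 0 else Efn u L x * mu x) ≤ (t : ℝ) ^ 2 * (Efn u L x * ∑ w : Tri t, wt x w * lind L w) := by
    intro x L
    by_cases hm : lmono x L
    · rw [psi_lind_mono x hm, if_pos hm]; simp
    · have hE := Efn_nonneg_of_not_lmono h hm
      refine ⟨mul_nonneg hE (psi_lind_nonneg x L), ?_⟩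
      rw [if_neg hm]
      have := psi_lind_bichro x hm
      calc 2 * (Efn u L x * mu x) = Efn u L x * (2 * mu x) := by ring
        _ ≤ Efn u L x * ((t : ℝ) ^ 2 * ∑ w : Tri t, wt x w * lind L w) := mul_le_mul_of_nonneg_left this hE
        _ = (t : ℝ) ^ 2 * (Efn u L x * ∑ w : Tri t, wt x w * lind L w) := by ring
  constructor
  · exact sum_nonneg fun x _ => sum_nonneg fun L _ => (key x L).1
  · unfold Bt Bq
    rw [mul_sum, mul_sum]
    refine sum_le_sum fun x _ => ?_
    rw [mul_sum, mul_sum]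
    exact sum_le_sum fun L _ => (key x L).2

/-- **Bound on `C`**: `|C| ≤ η · Fd³ · (S_off + S_on)`. -/
theorem C_le (h : IsLineFactND t ε η u v) : |Cq u v| ≤ η * Fd t ^ 3 * (Soff v + Son v) := by
  have hη := h.eta_nonneg
  have hsum : Soff v + Son v = ∑ L : Line t, ∑ w : Tri t, |Dfn v L w| := by
    unfold Soff Son
    rw [← sum_add_distrib]
    refine sum_congr rfl fun L _ => ?_
    rw [← sum_add_distrib]
    exact sum_congr rfl fun w _ => (abs_Dfn_eq h L w).symm
  calc |Cq u v| ≤ ∑ x : Col t, |∑ L : Line t, Efn u L x * ∑ w : Tri t, wt x w * Dfn v L w| :=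
        abs_sum_le_sum_abs _ _
    _ ≤ ∑ x : Col t, ∑ L : Line t, |Efn u L x * ∑ w : Tri t, wt x w * Dfn v L w| :=
        sum_le_sum fun x _ => abs_sum_le_sum_abs _ _
    _ ≤ ∑ x : Col t, ∑ L : Line t, η * ∑ w : Tri t, nw x w * |Dfn v L w| := by
        refine sum_le_sum fun x _ => sum_le_sum fun L _ => ?_
        calc |Efn u L x * ∑ w : Tri t, wt x w * Dfn v L w|
            = |Efn u L x| * |∑ w : Tri t, wt x w * Dfn v L w| := abs_mul _ _
          _ ≤ |Efn u L x| * ∑ w : Tri t, nw x w * |Dfn v L w| := by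
              refine mul_le_mul_of_nonneg_left ?_ (abs_nonneg _)
              calc |∑ w : Tri t, wt x w * Dfn v L w| ≤ ∑ w : Tri t, |wt x w * Dfn v L w| := abs_sum_le_sum_abs _ _
                _ ≤ ∑ w : Tri t, nw x w * |Dfn v L w| := sum_le_sum fun w _ => by
                    rw [abs_mul]; exact mul_le_mul_of_nonneg_right (abs_wt_le x w) (abs_nonneg _)
          _ = ∑ w : Tri t, |Efn u L x| * nw x w * |Dfn v L w| := by
              rw [mul_sum]; exact sum_congr rfl fun w _ => by ring
          _ ≤ ∑ w : Tri t, η * nw x w * |Dfn v L w| :=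
              sum_le_sum fun w _ => mul_le_mul_of_nonneg_right (abs_Efn_mul_nw_le h L x w) (abs_nonneg _)
          _ = η * ∑ w : Tri t, nw x w * |Dfn v L w| := by
              rw [mul_sum]; exact sum_congr rfl fun w _ => by ring
    _ = η * ∑ L : Line t, ∑ w : Tri t, (∑ x : Col t, nw x w) * |Dfn v L w| := by
        simp only [mul_sum, sum_mul]
        exact sum_comm.trans (sum_congr rfl fun L _ => sum_comm)
    _ = η * Fd t ^ 3 * (Soff v + Son v) := by
        simp only [sum_nw_col]
        rw [hsum]
        simp only [mul_sum]
        refine sum_congr rfl fun L _ => sum_congr rfl fun w _ => ?_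
        ring

/-- **The averaged identity and the bound on `C`, nondegenerate-closeness form** (registered sub-goal
`triangle_nd_identity` of stmt-PneNP-10680, verbatim signature). -/
theorem triangle_nd_identity : ∀ (t : ℕ) (ε η : ℝ) (u : Line t → Col t → ℝ) (v : Line t → Tri t → ℝ),
    IsLineFactND t ε η u v → Aq v + Bq u + Cq u v = -4 * ε * Mq t ∧ |Cq u v| ≤ η * Fd t ^ 3 * (Soff v + Son v) :=
  fun _ _ _ _ _ h => ⟨identity h, C_le h⟩


end

end Summit.PneNP.PneNP.Theorems.XorDoor.TriLine.ND
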